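import Mathlib
import Literature.Analysis.FluidPDE.SelfSimilarCollapseAnsatz
import Literature.Analysis.FluidPDE.SelfSimilarEulerOutgoingExclusion
import Literature.Analysis.FluidPDE.SelfSimilarEulerStagnationStretching
import Literature.Analysis.FluidPDE.SelfSimilarEulerBernoulliCap
import Literature.Analysis.FluidPDE.SelfSimilarEulerBernoulliSaddle
import Summits.NavierStokesRegularity.NavierStokesRegularity.Theorems.EulerZoomLiouvillePowerGaugeEulerLiouvilleSelfSimilarVorticity
import HarnessLib

/-!
# Rung C1 of the crux `EulerZoomLiouville.PowerGaugeEulerLiouville`: the OUTGOING stratum —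
# no self-similar Euler collapse whose profile has CIV's local outgoing property

Route №10 `EulerZoomLiouville` (NavierStokesRegularity), crux E = stmt-NavierStokesRegularity-19832
(`PowerGaugeEulerLiouville`), tenure rung C1 (exactly self-similar members of Seregin's power-gauged
ancient Euler class vanish). The route text (Theses/EulerZoomLiouville.lean, KILL TEST) names
Constantin–Ignatova–Vicol 2026 (arXiv:2602.17570) Thm 3.8 / Prop 3.9 / Thm 3.10 as the printed
constraints a refuting self-similar profile must survive: under the LOCAL OUTGOING PROPERTY of the
transport field `V = γ y + U` (Def. 3.7: finitely many stagnation points, `V(y)·(y − y_*) ≥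
c_*|y − y_*|²` near each, `c_* ≥ 0`) CIV prove `γ ≥ ½` when some node is vortical (Thm 3.8, tree) or
when the vorticity is real-analytic at the nodes (Thm 3.10). The tree now PROVES Thm 3.10 without the
analyticity hypothesis (`Literature/Analysis/FluidPDE/SelfSimilarEulerOutgoingExclusion.lean`,
`IsSelfSimilarEulerProfile.eq_zero_of_isLocallyOutgoing_of_exponent`: an Eulerian weighted
`L^{2a}`-vorticity identity with the Bernoulli weight `e^{λℋ}` replaces Prop 3.9 + analyticity +
the Lagrangian Cauchy formula). This file records the member-level consequence for the crux:

* `selfSimilar_profile_eq_zero_of_isLocallyOutgoing` — for EVERY `ρ > 0`, a classical stationary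
  self-similar Euler profile `(V, P)` with the class exponent `γ = 1/(2+ρ)` (`IsSelfSimilarEulerProfile
  (1/(2+ρ)) 0 V P`: `V ∈ C²`, `P ∈ C¹`, CIV (3.3)), CIV's far-field bounds (3.8)
  (`HasSelfSimilarFarField`) and the local outgoing property (`IsLocallyOutgoing`) is ZERO;
* `selfSimilar_ae_eq_zero_of_isLocallyOutgoing` — hence an exactly self-similar member
  `u(τ) = selfSimilarCollapse (1/(2+ρ)) 0 V τ` with such a profile vanishes on the slab
  `(−∞, 0) × ℝ³` (no weak-solution, gradient or gauge clause of the crux is even needed);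
* `not_isLocallyOutgoing_of_ne_zero` — the refuter-facing contrapositive: a NONTRIVIAL in-window
  classical profile with the decay (3.8) violates Def. 3.7 for every `(c_*, ε_*)`: its transport
  field has infinitely many stagnation points, or a stagnation point `y_*` with
  `V(y)·(y − y_*) < 0` at points `y` arbitrarily close to `y_*` (an inflow sector).

PORTRAIT (with the lineage's strata, KIT-INDEX-g4/g5): an in-window self-similar collapse candidate
with a classical profile must have the natural tails `|V| ~ |y|^{−(1+ρ)}`, `|Ω| ~ |y|^{−(2+ρ)}`,
feed Bernoulli energy inward through every small sphere, AND — new here — be NON-OUTGOING in CIV's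
sense at its stagnation set, whatever its vorticity does there.

WHAT THIS IS NOT: not NS, not E, not rung C1 whole — non-outgoing profiles (the generic case: the
stagnation set of `V` need not be finite, and inflow sectors are allowed by (3.3)) are untouched;
`V ∈ C²` makes this a statement about CLASSICAL profiles.

## References

* P. Constantin, M. Ignatova, V. Vicol, arXiv:2602.17570 (2026), §3.5 Def. 3.7, Thm. 3.10.
  [ConstantinIgnatovaVicol2026Putative]
-/

noncomputable section

set_option linter.dupNamespace false

open MeasureTheory Set Filter Topology Metric Function
open scoped ENNReal NNReal InnerProductSpace RealInnerProductSpace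

namespace Summit.NavierStokesRegularity.NavierStokesRegularity.Theorems.PowerGaugeEulerLiouville

open Literature.Analysis Literature.Analysis.FluidPDE

/-- **Rung C1, outgoing stratum, profile level (every `ρ > 0`).** A classical stationary
self-similar Euler profile with the class exponent `γ = 1/(2+ρ)`, CIV's far-field bounds (3.8) and
the local outgoing property of CIV Def. 3.7 is identically zero — CIV Thm 3.10 with the analyticity
hypothesis removed (tree: `IsSelfSimilarEulerProfile.eq_zero_of_isLocallyOutgoing_of_exponent`).
[cite: ConstantinIgnatovaVicol2026Putative, §3.5 Thm. 3.10] -/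
theorem selfSimilar_profile_eq_zero_of_isLocallyOutgoing {ρ : ℝ} (hρ : 0 < ρ)
    {V : EuclideanSpace ℝ (Fin 3) → EuclideanSpace ℝ (Fin 3)} {P : EuclideanSpace ℝ (Fin 3) → ℝ}
    (hprof : IsSelfSimilarEulerProfile (1 / (2 + ρ)) 0 V P)
    (hfar : HasSelfSimilarFarField (1 / (2 + ρ)) 0 V)
    {κ ε : ℝ} (hout : IsLocallyOutgoing (1 / (2 + ρ)) 0 V κ ε) : V = 0 :=
  hprof.eq_zero_of_isLocallyOutgoing_of_exponent hρ rfl hfar hout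

/-- **Rung C1, outgoing stratum, member level (every `ρ > 0`).** An exactly self-similar field
`u(τ) = selfSimilarCollapse (1/(2+ρ)) 0 V τ` (`τ < 0`) whose profile `(V, P)` is a classical
stationary self-similar Euler profile with the far-field bounds (3.8) and the local outgoing property
vanishes on the slab `(−∞,0) × ℝ³` (pointwise, hence a.e.). In particular no such member of
Seregin's power-gauged ancient Euler class is nontrivial. [cite: ConstantinIgnatovaVicol2026Putative, §3.5 Thm. 3.10] -/
theorem selfSimilar_ae_eq_zero_of_isLocallyOutgoing {ρ : ℝ} (hρ : 0 < ρ)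
    (u : ℝ → EuclideanSpace ℝ (Fin 3) → EuclideanSpace ℝ (Fin 3))
    (V : EuclideanSpace ℝ (Fin 3) → EuclideanSpace ℝ (Fin 3)) (P : EuclideanSpace ℝ (Fin 3) → ℝ)
    (hu : ∀ τ : ℝ, τ < 0 → u τ = selfSimilarCollapse (1 / (2 + ρ)) 0 V τ)
    (hprof : IsSelfSimilarEulerProfile (1 / (2 + ρ)) 0 V P)
    (hfar : HasSelfSimilarFarField (1 / (2 + ρ)) 0 V)
    {κ ε : ℝ} (hout : IsLocallyOutgoing (1 / (2 + ρ)) 0 V κ ε) :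
    uncurry u =ᵐ[volume.restrict (Iio (0 : ℝ) ×ˢ (univ : Set (EuclideanSpace ℝ (Fin 3))))] 0 := by
  have hV0 : V = 0 := selfSimilar_profile_eq_zero_of_isLocallyOutgoing hρ hprof hfar hout
  have hS : MeasurableSet (Iio (0 : ℝ) ×ˢ (univ : Set (EuclideanSpace ℝ (Fin 3)))) :=
    measurableSet_Iio.prod MeasurableSet.univ
  refine (ae_restrict_mem hS).mono fun z hz => ?_
  obtain ⟨hτ, -⟩ := hz
  have hτ' : z.1 < 0 := hτ
  change u z.1 z.2 = 0
  rw [hu z.1 hτ', hV0, selfSimilarCollapse_zero]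
  rfl

/-- **The refuter-facing form.** For `ρ > 0`, a NONTRIVIAL classical self-similar Euler profile with
the class exponent `1/(2+ρ)` and the far-field bounds (3.8) is NOT locally outgoing in CIV's sense
(Def. 3.7), for any constants `(c_*, ε_*)`: its transport field `V = y/(2+ρ) + V` has infinitely many
stagnation points, or at some stagnation point `y_*` the radial transport `⟪V(y), y − y_*⟫` is
negative at points arbitrarily close to `y_*`. [cite: ConstantinIgnatovaVicol2026Putative, §3.5 Thm. 3.10] -/
theorem not_isLocallyOutgoing_of_ne_zero {ρ : ℝ} (hρ : 0 < ρ)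
    {V : EuclideanSpace ℝ (Fin 3) → EuclideanSpace ℝ (Fin 3)} {P : EuclideanSpace ℝ (Fin 3) → ℝ}
    (hprof : IsSelfSimilarEulerProfile (1 / (2 + ρ)) 0 V P)
    (hfar : HasSelfSimilarFarField (1 / (2 + ρ)) 0 V) (hV : V ≠ 0) (κ ε : ℝ) :
    ¬ IsLocallyOutgoing (1 / (2 + ρ)) 0 V κ ε :=
  fun hout => hV (selfSimilar_profile_eq_zero_of_isLocallyOutgoing hρ hprof hfar hout)

/-! ## The stagnation-stretching stratum (sequel; no outgoing property, no far-field decay) -/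

/-- **Rung C1, stagnation-stretching stratum IN THE CLASS (every `ρ > 0`; no decay hypothesis
(3.8), no outgoing property).** Hypotheses: the three clauses of the route crux
`EulerZoomLiouville.PowerGaugeEulerLiouville` for `(u, p, H, c)` at exponent `ρ` (suitable weak
Euler on the slab, weak spatial gradient, power gauges `a^{2ρ}A + a^{ρ}E + a^{2ρ}D ≤ c`); `u`
exactly self-similar with a classical stationary profile `(V, P)` (`IsSelfSimilarEulerProfile
(1/(2+ρ)) 0 V P`); at every stagnation point `z` of the self-similar transport field
`y/(2+ρ) + V(y)` the stretching rates are uniformly below one, `⟪DV(z) w, w⟫ ≤ θ₀|w|²`, `θ₀ < 1`;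
and the radial transport is eventually outward, `⟪z/(2+ρ) + V(z), z⟫ ≥ 0` for `|z| ≥ R₀`. Then
`u = 0` a.e. on the slab. Proof: the profile is irrotational (tree
`IsSelfSimilarEulerProfile.curl_eq_zero_of_stagnation_stretching_le_of_outward` — the weighted
`L^{2a}` vorticity identity with the Bernoulli weight), so `DV` is symmetric and trace-free; the
`A`-gauge growth `∫_{B_L}|V|² ≤ c L^{1−2ρ}` (`profile_energy_growth_of_gaugeA`) then forces `V = 0`
a.e. (`ae_eq_zero_of_symm_traceFree_of_growth`), and the member vanishes
(`selfSimilar_ae_eq_zero_of_profile`) — the far-field bounds (3.8) of CIV are NOT used (ref3 C129).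
[cite: ConstantinIgnatovaVicol2026Putative, §3.5 Thm. 3.10 (proof, sharpened)] -/
theorem selfSimilar_ae_eq_zero_of_stagnation_stretching_le_of_outward {ρ : ℝ} (hρ : 0 < ρ)
    (u : ℝ → EuclideanSpace ℝ (Fin 3) → EuclideanSpace ℝ (Fin 3))
    (p : ℝ → EuclideanSpace ℝ (Fin 3) → ℝ)
    (H : ℝ → EuclideanSpace ℝ (Fin 3) → EuclideanSpace ℝ (Fin 3) →L[ℝ] EuclideanSpace ℝ (Fin 3))
    (c : ℝ≥0) (V : EuclideanSpace ℝ (Fin 3) → EuclideanSpace ℝ (Fin 3))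
    (P : EuclideanSpace ℝ (Fin 3) → ℝ)
    (_hsw : IsSuitableWeakSolutionOn (slab (EuclideanSpace ℝ (Fin 3)) (Iio 0) isOpen_Iio) 0 0 u p)
    (hH : HasWeakSpatialGradientOn (slab (EuclideanSpace ℝ (Fin 3)) (Iio 0) isOpen_Iio) u H)
    (hgauge : ∀ a : ℝ, 0 < a →
      ENNReal.ofReal (a ^ (2 * ρ)) * cknA a (0 : ℝ × EuclideanSpace ℝ (Fin 3)) u +
          ENNReal.ofReal (a ^ ρ) * cknE a (0 : ℝ × EuclideanSpace ℝ (Fin 3)) H +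
        ENNReal.ofReal (a ^ (2 * ρ)) * cknD a (0 : ℝ × EuclideanSpace ℝ (Fin 3)) p ≤ (c : ℝ≥0∞))
    (hu : ∀ τ : ℝ, τ < 0 → u τ = selfSimilarCollapse (1 / (2 + ρ)) 0 V τ)
    (hprof : IsSelfSimilarEulerProfile (1 / (2 + ρ)) 0 V P)
    {θ₀ : ℝ} (hθ₀ : θ₀ < 1)
    (hnode : ∀ z ∈ selfSimilarNodalSet (1 / (2 + ρ)) 0 V, ∀ w : EuclideanSpace ℝ (Fin 3),
      ⟪fderiv ℝ V z w, w⟫ ≤ θ₀ * ‖w‖ ^ 2)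
    {R₀ : ℝ} (hR₀ : 0 < R₀)
    (hout : ∀ y, R₀ ≤ ‖y - 0‖ → 0 ≤ ⟪selfSimilarTransport (1 / (2 + ρ)) 0 V y, y - 0⟫) :
    uncurry u =ᵐ[volume.restrict (Iio (0 : ℝ) ×ˢ (univ : Set (EuclideanSpace ℝ (Fin 3))))] 0 := by
  have h2ρ : (0 : ℝ) < 2 + ρ := by linarith
  have hγ : 0 < 1 / (2 + ρ) := by positivity
  have hγ2 : 1 / (2 + ρ) < 1 / 2 := one_div_lt_one_div_of_lt two_pos (by linarith)
  -- the profile is irrotational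
  have hcurl0 : curl V = 0 :=
    hprof.curl_eq_zero_of_stagnation_stretching_le_of_outward hγ hγ2 hθ₀ hnode hR₀ hout
  have hcurl : ∀ y, curl V y = 0 := fun y => congrFun hcurl0 y
  have hV1 : ContDiff ℝ 1 V := hprof.contDiff_velocity.of_le (by norm_num)
  have hVd : Differentiable ℝ V := hprof.differentiable_velocity
  -- its classical gradient is a weak gradient, symmetric and trace-free everywhere
  have hweak : HasWeakGradient V (fderiv ℝ V) := hasWeakGradient_fderiv_of_contDiff hV1
  have hsym : ∀ᵐ x ∂(volume : Measure (EuclideanSpace ℝ (Fin 3))), ∀ v w : EuclideanSpace ℝ (Fin 3),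
      ⟪fderiv ℝ V x v, w⟫ = ⟪fderiv ℝ V x w, v⟫ :=
    ae_of_all _ fun x v w => inner_fderiv_comm_of_curl_eq_zero (hVd x) (hcurl x) v w
  have htr : ∀ᵐ x ∂(volume : Measure (EuclideanSpace ℝ (Fin 3))),
      ∑ j, fderiv ℝ V x (EuclideanSpace.single j (1 : ℝ)) j = 0 := by
    refine ae_of_all _ fun x => ?_
    have h := hprof.divFree x
    rw [VectorCalculus.divergence, trace_eq_sum_coord] at h
    exact h
  -- the `A`-gauge growth, in the shape `∫_{B_r} ≤ ofReal (c r^{1−2ρ})`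
  have hA : ∀ a : ℝ, 0 < a → ENNReal.ofReal (a ^ (2 * ρ)) *
      cknA a (0 : ℝ × EuclideanSpace ℝ (Fin 3)) u ≤ (c : ℝ≥0∞) :=
    fun a ha => le_trans (le_trans le_self_add le_self_add) (hgauge a ha)
  have hgrowth0 := profile_energy_growth_of_gaugeA hρ hu hA
  have hgrowth : ∀ r : ℝ, (0 : ℝ) < r → 0 < r →
      ∫⁻ x in ball (0 : EuclideanSpace ℝ (Fin 3)) r, ‖V x‖ₑ ^ 2 ≤
        ENNReal.ofReal ((c : ℝ) * r ^ (1 - 2 * ρ)) := by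
    intro r _ hr
    have h := hgrowth0 r hr
    rwa [ENNReal.ofReal_mul c.coe_nonneg, ENNReal.ofReal_coe_nnreal]
  have hm : (1 - 2 * ρ : ℝ) < 3 := by linarith
  have hV0 : V =ᵐ[volume] 0 :=
    ae_eq_zero_of_symm_traceFree_of_growth hweak hsym htr hm hgrowth
  -- a member with vanishing profile vanishes
  have hum : AEStronglyMeasurable (uncurry u)
      (volume.restrict (Iio (0 : ℝ) ×ˢ (univ : Set (EuclideanSpace ℝ (Fin 3))))) := by
    have := hH.locallyIntegrableOn.aestronglyMeasurable
    simpa [slab] using this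
  exact selfSimilar_ae_eq_zero_of_profile hum hu hV0

/-- **Rung C1, stagnation-stretching stratum, profile level with CIV's decay (every `ρ > 0`).** A
classical stationary self-similar Euler profile with the class exponent `1/(2+ρ)` and the far-field
bounds (3.8) whose strain has all eigenvalues `< 1` at EVERY stagnation point of the self-similar
transport field is identically zero; equivalently a nontrivial such profile has a stagnation point
carrying a stretching rate `≥ 1` (tree
`IsSelfSimilarEulerProfile.exists_stagnation_stretching_ge_one`). [cite: ConstantinIgnatovaVicol2026Putative, §3.5 Thm. 3.10 (proof, sharpened)] -/
theorem selfSimilar_profile_eq_zero_of_stagnation_stretching_lt_one {ρ : ℝ} (hρ : 0 < ρ)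
    {V : EuclideanSpace ℝ (Fin 3) → EuclideanSpace ℝ (Fin 3)} {P : EuclideanSpace ℝ (Fin 3) → ℝ}
    (hprof : IsSelfSimilarEulerProfile (1 / (2 + ρ)) 0 V P)
    (hfar : HasSelfSimilarFarField (1 / (2 + ρ)) 0 V)
    (hnode : ∀ z ∈ selfSimilarNodalSet (1 / (2 + ρ)) 0 V, ∀ w : EuclideanSpace ℝ (Fin 3), w ≠ 0 →
      ⟪fderiv ℝ V z w, w⟫ < ‖w‖ ^ 2) : V = 0 :=
  hprof.eq_zero_of_stagnation_stretching_lt_one_of_exponent hρ rfl hfar hnode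

/-- **The refuter-facing form of the stagnation-stretching stratum.** For `ρ > 0`, a NONTRIVIAL
classical self-similar Euler profile with the class exponent `1/(2+ρ)` and the far-field bounds
(3.8) has a stagnation point `z` of `y/(2+ρ) + V` and a direction `w ≠ 0` with
`⟪DV(z) w, w⟫ ≥ |w|²`: the strain at `z` has an eigenvalue `≥ 1` (CIV's vortical nodes, Thm 3.8,
are the model case: `𝕊(z)Ω(z) = Ω(z)`). [cite: ConstantinIgnatovaVicol2026Putative, §3.5 Thm. 3.10 (proof, sharpened)] -/
theorem selfSimilar_exists_stagnation_stretching_ge_one {ρ : ℝ} (hρ : 0 < ρ)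
    {V : EuclideanSpace ℝ (Fin 3) → EuclideanSpace ℝ (Fin 3)} {P : EuclideanSpace ℝ (Fin 3) → ℝ}
    (hprof : IsSelfSimilarEulerProfile (1 / (2 + ρ)) 0 V P)
    (hfar : HasSelfSimilarFarField (1 / (2 + ρ)) 0 V) (hV : V ≠ 0) :
    ∃ z ∈ selfSimilarNodalSet (1 / (2 + ρ)) 0 V, ∃ w : EuclideanSpace ℝ (Fin 3), w ≠ 0 ∧
      ‖w‖ ^ 2 ≤ ⟪fderiv ℝ V z w, w⟫ := by
  have h2ρ : (0 : ℝ) < 2 + ρ := by linarith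
  exact hprof.exists_stagnation_stretching_ge_one (one_div_pos.2 h2ρ)
    (one_div_lt_one_div_of_lt two_pos (by linarith)) hfar hV

/-! ## The Bernoulli-landscape strata (sequel): two stagnation points, irrotational cap -/

/-- **Rung C1, the «single stagnation point» stratum (every `ρ > 0`).** A classical stationary
self-similar Euler profile with the class exponent `1/(2+ρ)` and CIV's far-field bounds (3.8) whose
self-similar transport field `y/(2+ρ) + V` has AT MOST ONE stagnation point (e.g. only the centre,
CIV's normalisation `𝒩_V ∋ 0`) is identically zero — a nontrivial in-window profile has at least two
stagnation points: the Bernoulli-top one (non-vortical, `DV ≥ 0`) and one with a strain eigenvalue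
`≥ 1` (tree: `IsSelfSimilarEulerProfile.exists_two_stagnation_points`). [cite: ConstantinIgnatovaVicol2026Putative, §3.4.3–§3.5 (sharpened; not in print)] -/
theorem selfSimilar_profile_eq_zero_of_nodalSet_subsingleton {ρ : ℝ} (hρ : 0 < ρ)
    {V : EuclideanSpace ℝ (Fin 3) → EuclideanSpace ℝ (Fin 3)} {P : EuclideanSpace ℝ (Fin 3) → ℝ}
    (hprof : IsSelfSimilarEulerProfile (1 / (2 + ρ)) 0 V P)
    (hfar : HasSelfSimilarFarField (1 / (2 + ρ)) 0 V)
    (hN : (selfSimilarNodalSet (1 / (2 + ρ)) 0 V).Subsingleton) : V = 0 := by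
  have h2ρ : (0 : ℝ) < 2 + ρ := by linarith
  exact hprof.eq_zero_of_selfSimilarNodalSet_subsingleton (one_div_pos.2 h2ρ)
    (one_div_lt_one_div_of_lt two_pos (by linarith)) hfar hN

/-- **Member level**: an exactly self-similar field `u(τ) = selfSimilarCollapse (1/(2+ρ)) 0 V τ`
whose classical profile has the far-field bounds (3.8) and at most one stagnation point of its
transport field vanishes on the slab `(−∞, 0) × ℝ³`. [cite: ConstantinIgnatovaVicol2026Putative, §3.4.3–§3.5 (sharpened; not in print)] -/
theorem selfSimilar_ae_eq_zero_of_nodalSet_subsingleton {ρ : ℝ} (hρ : 0 < ρ)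
    (u : ℝ → EuclideanSpace ℝ (Fin 3) → EuclideanSpace ℝ (Fin 3))
    (V : EuclideanSpace ℝ (Fin 3) → EuclideanSpace ℝ (Fin 3)) (P : EuclideanSpace ℝ (Fin 3) → ℝ)
    (hu : ∀ τ : ℝ, τ < 0 → u τ = selfSimilarCollapse (1 / (2 + ρ)) 0 V τ)
    (hprof : IsSelfSimilarEulerProfile (1 / (2 + ρ)) 0 V P)
    (hfar : HasSelfSimilarFarField (1 / (2 + ρ)) 0 V)
    (hN : (selfSimilarNodalSet (1 / (2 + ρ)) 0 V).Subsingleton) :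
    uncurry u =ᵐ[volume.restrict (Iio (0 : ℝ) ×ˢ (univ : Set (EuclideanSpace ℝ (Fin 3))))] 0 := by
  have hV0 : V = 0 := selfSimilar_profile_eq_zero_of_nodalSet_subsingleton hρ hprof hfar hN
  have hS : MeasurableSet (Iio (0 : ℝ) ×ˢ (univ : Set (EuclideanSpace ℝ (Fin 3)))) :=
    measurableSet_Iio.prod MeasurableSet.univ
  refine (ae_restrict_mem hS).mono fun z hz => ?_
  obtain ⟨hτ, -⟩ := hz
  have hτ' : z.1 < 0 := hτ
  change u z.1 z.2 = 0
  rw [hu z.1 hτ', hV0, selfSimilarCollapse_zero]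
  rfl

/-- **The refuter-facing portrait of the Bernoulli landscape (every `ρ > 0`).** For a NONTRIVIAL
classical profile with the class exponent and the far-field bounds (3.8): there are two distinct
stagnation points `z₁ ≠ z₂` of `y/(2+ρ) + V`, `z₁` maximising the Bernoulli function with
`⟪DV(z₁) w, w⟫ ≤ (2/(2+ρ))|w|²` for all `w`, and `z₂` carrying a direction `w ≠ 0` with
`⟪DV(z₂) w, w⟫ ≥ |w|²`; and the vorticity `curl V` vanishes on a nonempty open Bernoulli cap
`{ℋ > t} ∋ z₁`. [cite: ConstantinIgnatovaVicol2026Putative, §3.4.3–§3.5 (sharpened; not in print)] -/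
theorem selfSimilar_bernoulliLandscape_of_ne_zero {ρ : ℝ} (hρ : 0 < ρ)
    {V : EuclideanSpace ℝ (Fin 3) → EuclideanSpace ℝ (Fin 3)} {P : EuclideanSpace ℝ (Fin 3) → ℝ}
    (hprof : IsSelfSimilarEulerProfile (1 / (2 + ρ)) 0 V P) {C : ℝ}
    (hfar : HasSelfSimilarFarFieldWith (1 / (2 + ρ)) 0 C V) (hV : V ≠ 0) :
    (∃ z₁ ∈ selfSimilarNodalSet (1 / (2 + ρ)) 0 V, ∃ z₂ ∈ selfSimilarNodalSet (1 / (2 + ρ)) 0 V,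
      z₁ ≠ z₂ ∧ IsMaxOn (selfSimilarBernoulli (1 / (2 + ρ)) 0 V P) univ z₁ ∧
      (∀ w : EuclideanSpace ℝ (Fin 3), ⟪fderiv ℝ V z₁ w, w⟫ ≤ 2 * (1 / (2 + ρ)) * ‖w‖ ^ 2) ∧
      ∃ w : EuclideanSpace ℝ (Fin 3), w ≠ 0 ∧ ‖w‖ ^ 2 ≤ ⟪fderiv ℝ V z₂ w, w⟫) ∧
    ∃ t : ℝ, (∃ z ∈ selfSimilarNodalSet (1 / (2 + ρ)) 0 V,
        t < selfSimilarBernoulli (1 / (2 + ρ)) 0 V P z ∧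
        IsMaxOn (selfSimilarBernoulli (1 / (2 + ρ)) 0 V P) univ z) ∧
      ∀ y, t < selfSimilarBernoulli (1 / (2 + ρ)) 0 V P y → curl V y = 0 := by
  have h2ρ : (0 : ℝ) < 2 + ρ := by linarith
  have hγ : 0 < 1 / (2 + ρ) := one_div_pos.2 h2ρ
  have hγ2 : 1 / (2 + ρ) < 1 / 2 := one_div_lt_one_div_of_lt two_pos (by linarith)
  exact ⟨hprof.exists_two_stagnation_points hγ hγ2 ⟨C, hfar⟩ hV,
    hprof.exists_irrotational_bernoulliCap hγ hγ2 hfar⟩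

/-! ## The inflow-saddle stratum (sequel): where Def 3.7 fails -/

/-- **Rung C1, refuter-facing: the non-vortical inflow stagnation point (every `ρ > 0`).** A
NONTRIVIAL classical stationary self-similar Euler profile with the class exponent `1/(2+ρ)` and
CIV's far-field bounds (3.8) has a stagnation point `z` of `y/(2+ρ) + V` which is NON-vortical
(`curl V z = 0`), carries a stretching direction `⟪DV(z) w, w⟫ ≥ |w|²` (`w ≠ 0`) AND a linearly
inflowing direction `|h|²/(2+ρ) + ⟪DV(z) h, h⟫ < 0` — so CIV's outgoing inequality (Def. 3.7) fails
at `z` already to first order — and above whose Bernoulli level the profile is irrotational (tree: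
`IsSelfSimilarEulerProfile.exists_nonvortical_inflow_stagnation`). A refuting in-window member's
profile must exhibit such a saddle. [cite: ConstantinIgnatovaVicol2026Putative, §3.5 Def. 3.7 / Thm. 3.10 (sharpened; not in print)] -/
theorem selfSimilar_exists_nonvortical_inflow_stagnation {ρ : ℝ} (hρ : 0 < ρ)
    {V : EuclideanSpace ℝ (Fin 3) → EuclideanSpace ℝ (Fin 3)} {P : EuclideanSpace ℝ (Fin 3) → ℝ}
    (hprof : IsSelfSimilarEulerProfile (1 / (2 + ρ)) 0 V P) {C : ℝ}
    (hfar : HasSelfSimilarFarFieldWith (1 / (2 + ρ)) 0 C V) (hV : V ≠ 0) :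
    ∃ z ∈ selfSimilarNodalSet (1 / (2 + ρ)) 0 V, curl V z = 0 ∧
      (∃ w : EuclideanSpace ℝ (Fin 3), w ≠ 0 ∧ ‖w‖ ^ 2 ≤ ⟪fderiv ℝ V z w, w⟫) ∧
      (∃ v : EuclideanSpace ℝ (Fin 3), 1 / (2 + ρ) * ‖v‖ ^ 2 + ⟪fderiv ℝ V z v, v⟫ < 0) ∧
      ∀ y, selfSimilarBernoulli (1 / (2 + ρ)) 0 V P z < selfSimilarBernoulli (1 / (2 + ρ)) 0 V P y →
        curl V y = 0 := by
  have h2ρ : (0 : ℝ) < 2 + ρ := by linarith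
  exact hprof.exists_nonvortical_inflow_stagnation (one_div_pos.2 h2ρ)
    (one_div_lt_one_div_of_lt two_pos (by linarith)) hfar hV

end Summit.NavierStokesRegularity.NavierStokesRegularity.Theorems.PowerGaugeEulerLiouville

end
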